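import Literature.NumberTheory.GaloisRepresentations.GaloisRep
import Literature.NumberTheory.GaloisRepresentations.CyclotomicDeterminantImageProofs
import Literature.NumberTheory.GaloisRepresentations.ModPGaloisRepCyclotomicProofs
import Literature.RepresentationTheory.Semisimple.BurnsideMatrixSpan
import Literature.RepresentationTheory.Semisimple.IrreducibleOfCharpoly
import Mathlib.LinearAlgebra.Matrix.GeneralLinearGroup.Card
import HarnessLib

/-!
# Residual representations with image `Δ_p ⋊ C₂ ⊇ SL₂(𝔽_p) ≀ C₂`: order of the image,
# irreducibility over `ℚ(ζ_p)` and over `ℚ`, reducibility over the quadratic field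

Topic `Literature/NumberTheory/GaloisRepresentations`; a *proofs* file (theorems only, no
definition, no named fact, no `sorry`).

In the proof of Lemma 10.4.1 of G. Boxer, F. Calegari, T. Gee, V. Pilloni, *Modularity theorems
for abelian surfaces* (arXiv:2502.20645), p. 146 (type **B**[C₂] paragraph), the residual
representation `ρ̄ = ρ̄_{A,p} : G_ℚ → GSp₄(𝔽_p)` of an abelian surface `A/ℚ` of Galois type
**B**[C₂] with quadratic field `K` is shown, for a density-one set of primes `p` split in
`E = End(A_K) ⊗ ℚ` [cite: BoxerEtAl2021, §9.2 (Lemma 9.2.2, Lemma 9.2.5)], to have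
`ρ̄(G_K) = Δ_p := {(a, c) ∈ GL₂(𝔽_p)² : det a = det c}` (block-diagonally),
`ρ̄(G_ℚ) = Δ_p ⋊ ⟨w⟩` (`w` the block swap) and `ρ̄(G_{ℚ(ζ_{p^∞})}) = SL₂(𝔽_p) ≀ ℤ/2ℤ`, "so that
`ρ̄_{A,p}` satisfies the hypotheses" of Serre's conjecture for `GSp₄` in regular (ordinary)
weight [cite: BoxerCalegariGeePilloni2025, proof of Lemma 10.4.1 (p. 146)].  The tree states that
conjecture, at exactly these residues, as the hypothesis of the named fact
`Literature.NumberTheory.DiophantineGeometry.bcgp_serreWreathFixedSimilitude_implies_quadraticImprimitiveSurfacesModular`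
(`BcgpSerreWreathFixedSimilitudeImprimitiveSurfaces.lean`), whose residue conditions are:
`ρ̄` irreducible, `|ρ̄(Γ_ℚ)| = 2 p² (p − 1) (p² − 1)²`, `ρ̄|_{Γ_{ℚ(ζ_p)}}` irreducible,
`ρ̄|_{Γ_{K'}}` reducible for some quadratic `K'`.  This file PROVES that the three image
statements imply those four conditions (elementary group theory and linear algebra, made explicit
here because the source leaves it to the reader):

* `SL2Wreath.span_wreath_eq_top` — for a field homomorphism `ι : F → k` with `2 ≠ 0` in `k`, the
  `k`-span of `SL₂(F) ≀ C₂ ⊆ M₄(k)` (block-diagonal and block-antidiagonal matrices with blocks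
  `ι a, ι c`, `a, c ∈ SL₂(F)`) is `M₄(k)`: the differences `a − 1` for
  `a = 1 + E₀₁, 1 + E₁₀, !![1,1;1,2], −1 ∈ SL₂(F)` span `M₂`
  (`SL2Wreath.linearMap_mem_of_forall_sl2`); [folklore]
* `SL2Wreath.natCard_specialLinearGroup_fin_two` — `|SL₂(𝔽_q)| = q (q² − 1)`, from Mathlib's
  `Matrix.card_GL_field` (`|GL₂(𝔽_q)| = (q² − 1)(q² − q)`) and the bijection
  `GL₂ ≃ 𝔽_qˣ × SL₂`, `a ↦ (det a, diag(det a, 1)⁻¹ a)`; [folklore]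
* `SL2Wreath.natCard_wreath_setOf` — `|Δ(𝔽_q) ⋊ C₂| = 2 q² (q − 1) (q² − 1)²` for the set of
  matrices `diag(ι a, ι c)`, `antidiag(ι a, ι c)`, `det a = det c ≠ 0`, via
  `Δ ≃ 𝔽_qˣ × SL₂ × SL₂`; [folklore]
* `isIrreducible_restrictField_cyclotomicField_of_image_ker_cyclotomic` — if in some frame the
  image of `ker χ_p` under `ρ̄ : Γ_ℚ → GL₄(k)` (`char k = p` odd) is `SL₂(𝔽_p) ≀ C₂`, then
  `ρ̄|_{Γ_{ℚ(ζ_p)}}` is irreducible: `Γ_{ℚ(ζ_p)} ⊇ ker χ̄_p ⊇ ker χ_p`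
  (`mem_range_absGaloisRestrict_of_modPCyclotomicCharacterZMod_eq_one`,
  `toZMod_cyclotomicCharacter_apply`) and a subspace stable under a set of matrices spanning
  `M₄(k)` is `0` or everything (`isIrreducible_of_span_eq_top`, `BurnsideMatrixSpan.lean`);
  hence (`FramedGaloisRep.isIrreducible_of_restrictField`) `ρ̄` itself is irreducible
  (`isIrreducible_of_image_ker_cyclotomic`);
* `not_isIrreducible_restrictField_of_range_blockDiagonal` — if the image of `Γ_K` is
  block-diagonal in the frame `g`, then `g⁻¹(k e₀ ⊕ k e₁)` is a `Γ_K`-stable plane, so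
  `ρ̄|_{Γ_K}` is reducible;
* `natCard_range_of_range_eq_wreath` — if the image of `Γ_ℚ` in the frame `g` is `Δ_p ⋊ C₂`, then
  `|ρ̄(Γ_ℚ)| = 2 p² (p − 1) (p² − 1)²` (conjugation by `g` and `GL₄(k) → M₄(k)` are injective);
* `range_eq_wreath_of_range_restrictField_of_image_ker_cyclotomic` — the image of `Γ_ℚ` is
  `Δ_p ⋊ C₂` as soon as (in the frame `g`) the image of `Γ_K`, `K` quadratic, is `Δ_p` and the
  image of `ker χ_p` is `SL₂(𝔽_p) ≀ C₂` (the two statements actually PRINTED on p. 146): the block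
  swap is the image of some `τ₀ ∈ ker χ_p ∖ Γ_K`, `[Γ_ℚ : Γ_K] = 2`
  (`index_range_absGaloisRestrict_eq_finrank'`, `Subgroup.mul_mem_iff_of_index_two`) and
  `antidiag(1,1) · diag(a, c) = antidiag(c, a)`; packaged with the two given clauses as
  `wreathImages_of_range_restrictField_of_image_ker_cyclotomic`;
* `serreWreathResidueConditions_of_images` — the conjunction, with the three image clauses stated
  VERBATIM as in the binder `hgood` of
  `Literature.NumberTheory.DiophantineGeometry.bcgp_serreWreathFixedSimilitude_implies_quadraticImprimitiveSurfacesModular_of_modularityLifting_of_goodPrimes_of_remainingTypes`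
  (`BcgpSerreWreathFixedSimilitudeImprimitiveSurfacesProofs.lean`) and the conclusion verbatim
  its last four conjuncts — so that those conjuncts can be DROPPED from that binder (they were an
  echo of the Serre hypothesis, not part of the printed good-prime statement).

First consumer: the sharpened reduction
`…_of_modularityLifting_of_goodPrimes'_of_remainingTypes` in
`BcgpSerreWreathFixedSimilitudeImprimitiveSurfacesProofs.lean` (same seat).  Conventions: block
matrices are `Matrix.reindex finSumFinEquiv finSumFinEquiv (Matrix.fromBlocks A B C D)` on
`Fin 4`, exactly as in the consumer; `𝔽_p → k` is `ZMod.castHom (dvd_refl p) k`; the `p`-adic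
cyclotomic character is the tree's `GaloisRep.cyclotomicCharacter ℚ p` and `Γ_L → Γ_ℚ` is the
tree's `absGaloisRestrict ℚ L` (`FramedGaloisRep.restrictField`).

## References

* G. Boxer, F. Calegari, T. Gee, V. Pilloni, *Modularity theorems for abelian surfaces*,
  arXiv:2502.20645 (2025), proof of Lemma 10.4.1, p. 146 [BoxerCalegariGeePilloni2025].
* G. Boxer, F. Calegari, T. Gee, V. Pilloni, *Abelian surfaces over totally real fields are
  potentially modular*, Publ. Math. IHÉS 134 (2021), §9.2 [BoxerEtAl2021].
* S. Lang, *Algebra*, 3rd ed., XIII §8–9 (orders of `GL_n(𝔽_q)`, `SL_n(𝔽_q)`). [folklore]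
-/

noncomputable section

open scoped MatrixGroups
open Matrix

namespace Literature.NumberTheory.GaloisRepresentations

namespace SL2Wreath

/-! ### Block matrices `Fin 4 = Fin 2 ⊕ Fin 2` -/

section Blocks

variable {k : Type*}

/-- Subtraction of `2 + 2` block matrices reindexed to `Fin 4`. [folklore] -/
theorem reindex_fromBlocks_sub [Ring k] (A B C D A' B' C' D' : Matrix (Fin 2) (Fin 2) k) :
    Matrix.reindex finSumFinEquiv finSumFinEquiv (Matrix.fromBlocks A B C D) -
        Matrix.reindex finSumFinEquiv finSumFinEquiv (Matrix.fromBlocks A' B' C' D') =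
      Matrix.reindex finSumFinEquiv finSumFinEquiv
        (Matrix.fromBlocks (A - A') (B - B') (C - C') (D - D')) := by
  ext i j
  fin_cases i <;> fin_cases j <;> rfl

/-- Addition of `2 + 2` block matrices reindexed to `Fin 4`. [folklore] -/
theorem reindex_fromBlocks_add [Ring k] (A B C D A' B' C' D' : Matrix (Fin 2) (Fin 2) k) :
    Matrix.reindex finSumFinEquiv finSumFinEquiv (Matrix.fromBlocks A B C D) +
        Matrix.reindex finSumFinEquiv finSumFinEquiv (Matrix.fromBlocks A' B' C' D') =
      Matrix.reindex finSumFinEquiv finSumFinEquiv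
        (Matrix.fromBlocks (A + A') (B + B') (C + C') (D + D')) := by
  ext i j
  fin_cases i <;> fin_cases j <;> rfl

/-- Scalar multiplication of `2 + 2` block matrices reindexed to `Fin 4`. [folklore] -/
theorem reindex_fromBlocks_smul [Ring k] (c : k) (A B C D : Matrix (Fin 2) (Fin 2) k) :
    c • Matrix.reindex finSumFinEquiv finSumFinEquiv (Matrix.fromBlocks A B C D) =
      Matrix.reindex finSumFinEquiv finSumFinEquiv
        (Matrix.fromBlocks (c • A) (c • B) (c • C) (c • D)) := by
  ext i j
  fin_cases i <;> fin_cases j <;> rfl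

/-- Block matrices reindexed to `Fin 4` are determined by their blocks. [folklore] -/
theorem reindex_fromBlocks_inj {A B C D A' B' C' D' : Matrix (Fin 2) (Fin 2) k}
    (h : Matrix.reindex finSumFinEquiv finSumFinEquiv (Matrix.fromBlocks A B C D) =
      Matrix.reindex finSumFinEquiv finSumFinEquiv (Matrix.fromBlocks A' B' C' D')) :
    A = A' ∧ B = B' ∧ C = C' ∧ D = D' :=
  Matrix.fromBlocks_inj.1 ((Matrix.reindex _ _).injective h)

/-- Every `4 × 4` matrix is a `2 + 2` block matrix. [folklore] -/
theorem exists_eq_reindex_fromBlocks (M : Matrix (Fin 4) (Fin 4) k) :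
    ∃ A B C D : Matrix (Fin 2) (Fin 2) k,
      M = Matrix.reindex finSumFinEquiv finSumFinEquiv (Matrix.fromBlocks A B C D) := by
  set M' : Matrix (Fin 2 ⊕ Fin 2) (Fin 2 ⊕ Fin 2) k :=
    (Matrix.reindex (finSumFinEquiv (m := 2) (n := 2)) (finSumFinEquiv (m := 2) (n := 2))).symm M
    with hM'
  refine ⟨M'.toBlocks₁₁, M'.toBlocks₁₂, M'.toBlocks₂₁, M'.toBlocks₂₂, ?_⟩
  rw [Matrix.fromBlocks_toBlocks, hM', Equiv.apply_symm_apply]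

/-- Third coordinate of a block-diagonal matrix applied to a vector (stated for a matrix
`M : Matrix (Fin 4) (Fin 4) k` EQUAL to a reindexed block matrix, the form in which block
matrices occur in image hypotheses). [folklore] -/
theorem mulVec_apply_two_of_eq_fromBlocks [CommRing k] {M : Matrix (Fin 4) (Fin 4) k}
    {A D : Matrix (Fin 2) (Fin 2) k}
    (hM : M = Matrix.reindex finSumFinEquiv finSumFinEquiv (Matrix.fromBlocks A 0 0 D))
    (u : Fin 4 → k) : (M *ᵥ u) 2 = D 0 0 * u 2 + D 0 1 * u 3 := by
  subst hM
  simp only [Matrix.mulVec, dotProduct, Fin.sum_univ_four]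
  change (0 : k) * u 0 + 0 * u 1 + D 0 0 * u 2 + D 0 1 * u 3 = _
  ring

/-- Fourth coordinate of a block-diagonal matrix applied to a vector. [folklore] -/
theorem mulVec_apply_three_of_eq_fromBlocks [CommRing k] {M : Matrix (Fin 4) (Fin 4) k}
    {A D : Matrix (Fin 2) (Fin 2) k}
    (hM : M = Matrix.reindex finSumFinEquiv finSumFinEquiv (Matrix.fromBlocks A 0 0 D))
    (u : Fin 4 → k) : (M *ᵥ u) 3 = D 1 0 * u 2 + D 1 1 * u 3 := by
  subst hM
  simp only [Matrix.mulVec, dotProduct, Fin.sum_univ_four]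
  change (0 : k) * u 0 + 0 * u 1 + D 1 0 * u 2 + D 1 1 * u 3 = _
  ring

end Blocks

/-! ### Four elements of `SL₂` whose differences with `1` span `M₂` -/

section SL2Elements

variable {F : Type*} [CommRing F]

/-- `det (1 + E₀₁) = 1`. [folklore] -/
theorem det_one_add_single_zero_one :
    (1 + Matrix.single 0 1 (1 : F) : Matrix (Fin 2) (Fin 2) F).det = 1 := by
  simp [Matrix.det_fin_two]

/-- `det (1 + E₁₀) = 1`. [folklore] -/
theorem det_one_add_single_one_zero :
    (1 + Matrix.single 1 0 (1 : F) : Matrix (Fin 2) (Fin 2) F).det = 1 := by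
  simp [Matrix.det_fin_two]

/-- `det !![1, 1; 1, 2] = 1`. [folklore] -/
theorem det_one_add_single_add_single_add_single :
    (1 + Matrix.single 0 1 (1 : F) + Matrix.single 1 0 1 + Matrix.single 1 1 1 :
      Matrix (Fin 2) (Fin 2) F).det = 1 := by
  simp [Matrix.det_fin_two]

/-- `det (-1) = 1` in `M₂`. [folklore] -/
theorem det_neg_one_fin_two : (-1 : Matrix (Fin 2) (Fin 2) F).det = 1 := by
  simp [Matrix.det_fin_two]

end SL2Elements

/-! ### The wreath product `SL₂(F) ≀ C₂ ⊆ M₄(k)` spans `M₄(k)` -/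

section Span

variable {F : Type*} [Field F] {k : Type*} [Field k] (ι : F →+* k)

/-- **Key linear-algebra step.** Let `L : M₂(k) →ₗ M₄(k)` be `k`-linear and `T ⊆ M₄(k)` a
subspace containing `L (ι(a) − 1)` for every `a ∈ SL₂(F)`.  If `2 ≠ 0` in `k`, then `L(N) ∈ T`
for every `N ∈ M₂(k)`: the differences `a − 1` for `a = 1 + E₀₁, 1 + E₁₀, !![1,1;1,2], −1`
are `E₀₁, E₁₀, E₀₁ + E₁₀ + E₁₁, −2`, which span `M₂`. [folklore] -/
theorem linearMap_mem_of_forall_sl2 (h2 : (2 : k) ≠ 0)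
    (L : Matrix (Fin 2) (Fin 2) k →ₗ[k] Matrix (Fin 4) (Fin 4) k)
    (T : Submodule k (Matrix (Fin 4) (Fin 4) k))
    (hT : ∀ a : Matrix (Fin 2) (Fin 2) F, a.det = 1 → L (a.map ι - 1) ∈ T)
    (N : Matrix (Fin 2) (Fin 2) k) : L N ∈ T := by
  have hι1 : ((1 : Matrix (Fin 2) (Fin 2) F).map ι) = 1 := Matrix.map_one ι (map_zero ι) (map_one ι)
  -- the four differences
  have h01 : L (Matrix.single 0 1 1) ∈ T := by
    have := hT _ det_one_add_single_zero_one
    rwa [Matrix.map_add _ (map_add ι), hι1, Matrix.map_single, map_one, add_sub_cancel_left] at this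
  have h10 : L (Matrix.single 1 0 1) ∈ T := by
    have := hT _ det_one_add_single_one_zero
    rwa [Matrix.map_add _ (map_add ι), hι1, Matrix.map_single, map_one, add_sub_cancel_left] at this
  have h11 : L (Matrix.single 1 1 1) ∈ T := by
    have := hT _ det_one_add_single_add_single_add_single
    rw [Matrix.map_add _ (map_add ι), Matrix.map_add _ (map_add ι), Matrix.map_add _ (map_add ι),
      hι1, Matrix.map_single,
      Matrix.map_single, Matrix.map_single, map_one, show (1 : Matrix (Fin 2) (Fin 2) k) +
        Matrix.single 0 1 1 + Matrix.single 1 0 1 + Matrix.single 1 1 1 - 1 =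
        Matrix.single 0 1 1 + Matrix.single 1 0 1 + Matrix.single 1 1 1 by abel,
      map_add, map_add] at this
    have h' := T.sub_mem (T.sub_mem this h01) h10
    rwa [show L (Matrix.single 0 1 1) + L (Matrix.single 1 0 1) + L (Matrix.single 1 1 1) -
        L (Matrix.single 0 1 1) - L (Matrix.single 1 0 1) = L (Matrix.single 1 1 1) by abel] at h'
  have hone : L 1 ∈ T := by
    have := hT _ det_neg_one_fin_two
    rw [Matrix.map_neg _ (map_neg ι), hι1, show (-1 : Matrix (Fin 2) (Fin 2) k) - 1 = (-2 : k) • 1 by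
      rw [neg_smul, two_smul]; abel, map_smul] at this
    have h' := T.smul_mem (-2 : k)⁻¹ this
    rwa [inv_smul_smul₀ (neg_ne_zero.2 h2)] at h'
  have h00 : L (Matrix.single 0 0 1) ∈ T := by
    have h' := T.sub_mem hone h11
    rw [← map_sub] at h'
    have e : (1 : Matrix (Fin 2) (Fin 2) k) - Matrix.single 1 1 1 = Matrix.single 0 0 1 := by
      ext i j
      fin_cases i <;> fin_cases j <;> simp
    rwa [e] at h'
  -- decompose `N`
  have hN : N = N 0 0 • Matrix.single 0 0 1 + N 0 1 • Matrix.single 0 1 1 +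
      N 1 0 • Matrix.single 1 0 1 + N 1 1 • Matrix.single 1 1 1 := by
    rw [Matrix.matrix_eq_sum_single N]
    simp [Fin.sum_univ_two, Matrix.smul_single, add_assoc]
  rw [hN, map_add, map_add, map_add, map_smul, map_smul, map_smul, map_smul]
  exact T.add_mem (T.add_mem (T.add_mem (T.smul_mem _ h00) (T.smul_mem _ h01))
    (T.smul_mem _ h10)) (T.smul_mem _ h11)

/-- **`SL₂(F) ≀ C₂` spans `M₄(k)`.**  For a field homomorphism `ι : F → k` with `2 ≠ 0` in `k`,
the `k`-span of the block matrices `diag(ι a, ι c)` and `antidiag(ι a, ι c)` with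
`a, c ∈ SL₂(F)` is all of `M₄(k)`. [folklore] -/
theorem span_wreath_eq_top (h2 : (2 : k) ≠ 0) :
    Submodule.span k
      {M : Matrix (Fin 4) (Fin 4) k | ∃ a c : Matrix (Fin 2) (Fin 2) F, a.det = 1 ∧ c.det = 1 ∧
        (M = Matrix.reindex finSumFinEquiv finSumFinEquiv
            (Matrix.fromBlocks (a.map ι) 0 0 (c.map ι)) ∨
         M = Matrix.reindex finSumFinEquiv finSumFinEquiv
            (Matrix.fromBlocks 0 (a.map ι) (c.map ι) 0))} = ⊤ := by
  set S := {M : Matrix (Fin 4) (Fin 4) k | ∃ a c : Matrix (Fin 2) (Fin 2) F,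
      a.det = 1 ∧ c.det = 1 ∧
        (M = Matrix.reindex finSumFinEquiv finSumFinEquiv
            (Matrix.fromBlocks (a.map ι) 0 0 (c.map ι)) ∨
         M = Matrix.reindex finSumFinEquiv finSumFinEquiv
            (Matrix.fromBlocks 0 (a.map ι) (c.map ι) 0))} with hS
  set T := Submodule.span k S with hT
  have hι1 : ((1 : Matrix (Fin 2) (Fin 2) F).map ι) = 1 := Matrix.map_one ι (map_zero ι) (map_one ι)
  -- generators
  have hdiag : ∀ a c : Matrix (Fin 2) (Fin 2) F, a.det = 1 → c.det = 1 →
      Matrix.reindex finSumFinEquiv finSumFinEquiv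
        (Matrix.fromBlocks (a.map ι) 0 0 (c.map ι)) ∈ T := fun a c ha hc =>
    Submodule.subset_span ⟨a, c, ha, hc, Or.inl rfl⟩
  have hanti : ∀ a c : Matrix (Fin 2) (Fin 2) F, a.det = 1 → c.det = 1 →
      Matrix.reindex finSumFinEquiv finSumFinEquiv
        (Matrix.fromBlocks 0 (a.map ι) (c.map ι) 0) ∈ T := fun a c ha hc =>
    Submodule.subset_span ⟨a, c, ha, hc, Or.inr rfl⟩
  -- the four corner embeddings
  let L₁₁ : Matrix (Fin 2) (Fin 2) k →ₗ[k] Matrix (Fin 4) (Fin 4) k :=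
    { toFun := fun N => Matrix.reindex finSumFinEquiv finSumFinEquiv (Matrix.fromBlocks N (0 : Matrix (Fin 2) (Fin 2) k) (0 : Matrix (Fin 2) (Fin 2) k) 0)
      map_add' := fun N N' => by
        rw [reindex_fromBlocks_add, add_zero]
      map_smul' := fun c N => by
        rw [RingHom.id_apply, reindex_fromBlocks_smul, smul_zero] }
  let L₁₂ : Matrix (Fin 2) (Fin 2) k →ₗ[k] Matrix (Fin 4) (Fin 4) k :=
    { toFun := fun N => Matrix.reindex finSumFinEquiv finSumFinEquiv (Matrix.fromBlocks (0 : Matrix (Fin 2) (Fin 2) k) N 0 (0 : Matrix (Fin 2) (Fin 2) k))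
      map_add' := fun N N' => by
        rw [reindex_fromBlocks_add, add_zero]
      map_smul' := fun c N => by
        rw [RingHom.id_apply, reindex_fromBlocks_smul, smul_zero] }
  let L₂₁ : Matrix (Fin 2) (Fin 2) k →ₗ[k] Matrix (Fin 4) (Fin 4) k :=
    { toFun := fun N => Matrix.reindex finSumFinEquiv finSumFinEquiv (Matrix.fromBlocks (0 : Matrix (Fin 2) (Fin 2) k) 0 N (0 : Matrix (Fin 2) (Fin 2) k))
      map_add' := fun N N' => by
        rw [reindex_fromBlocks_add, add_zero]
      map_smul' := fun c N => by
        rw [RingHom.id_apply, reindex_fromBlocks_smul, smul_zero] }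
  let L₂₂ : Matrix (Fin 2) (Fin 2) k →ₗ[k] Matrix (Fin 4) (Fin 4) k :=
    { toFun := fun N => Matrix.reindex finSumFinEquiv finSumFinEquiv (Matrix.fromBlocks (0 : Matrix (Fin 2) (Fin 2) k) (0 : Matrix (Fin 2) (Fin 2) k) 0 N)
      map_add' := fun N N' => by
        rw [reindex_fromBlocks_add, add_zero]
      map_smul' := fun c N => by
        rw [RingHom.id_apply, reindex_fromBlocks_smul, smul_zero] }
  have h₁₁ : ∀ N, L₁₁ N ∈ T := by
    refine linearMap_mem_of_forall_sl2 ι h2 L₁₁ T fun a ha => ?_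
    have h := T.sub_mem (hdiag a 1 ha Matrix.det_one) (hdiag 1 1 Matrix.det_one Matrix.det_one)
    rw [reindex_fromBlocks_sub, hι1, sub_self, sub_self] at h
    exact h
  have h₂₂ : ∀ N, L₂₂ N ∈ T := by
    refine linearMap_mem_of_forall_sl2 ι h2 L₂₂ T fun c hc => ?_
    have h := T.sub_mem (hdiag 1 c Matrix.det_one hc) (hdiag 1 1 Matrix.det_one Matrix.det_one)
    rw [reindex_fromBlocks_sub, hι1, sub_self, sub_self] at h
    exact h
  have h₁₂ : ∀ N, L₁₂ N ∈ T := by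
    refine linearMap_mem_of_forall_sl2 ι h2 L₁₂ T fun a ha => ?_
    have h := T.sub_mem (hanti a 1 ha Matrix.det_one) (hanti 1 1 Matrix.det_one Matrix.det_one)
    rw [reindex_fromBlocks_sub, hι1, sub_self, sub_self] at h
    exact h
  have h₂₁ : ∀ N, L₂₁ N ∈ T := by
    refine linearMap_mem_of_forall_sl2 ι h2 L₂₁ T fun c hc => ?_
    have h := T.sub_mem (hanti 1 c Matrix.det_one hc) (hanti 1 1 Matrix.det_one Matrix.det_one)
    rw [reindex_fromBlocks_sub, hι1, sub_self, sub_self] at h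
    exact h
  -- every matrix is a sum of its four corners
  rw [eq_top_iff]
  rintro M -
  obtain ⟨A, B, C, D, rfl⟩ := exists_eq_reindex_fromBlocks M
  have e : Matrix.reindex finSumFinEquiv finSumFinEquiv (Matrix.fromBlocks A B C D) =
      L₁₁ A + L₁₂ B + L₂₁ C + L₂₂ D := by
    change _ = Matrix.reindex finSumFinEquiv finSumFinEquiv
        (Matrix.fromBlocks A (0 : Matrix (Fin 2) (Fin 2) k) (0 : Matrix (Fin 2) (Fin 2) k) 0) +
      Matrix.reindex finSumFinEquiv finSumFinEquiv
        (Matrix.fromBlocks (0 : Matrix (Fin 2) (Fin 2) k) B 0 (0 : Matrix (Fin 2) (Fin 2) k)) +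
      Matrix.reindex finSumFinEquiv finSumFinEquiv
        (Matrix.fromBlocks (0 : Matrix (Fin 2) (Fin 2) k) 0 C (0 : Matrix (Fin 2) (Fin 2) k)) +
      Matrix.reindex finSumFinEquiv finSumFinEquiv
        (Matrix.fromBlocks (0 : Matrix (Fin 2) (Fin 2) k) (0 : Matrix (Fin 2) (Fin 2) k) 0 D)
    rw [reindex_fromBlocks_add, reindex_fromBlocks_add, reindex_fromBlocks_add]
    simp
  rw [e]
  exact T.add_mem (T.add_mem (T.add_mem (h₁₁ A) (h₁₂ B)) (h₂₁ C)) (h₂₂ D)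

end Span

/-! ### Counting: `|SL₂(F)| = q (q² − 1)` and `|Δ(F) ⋊ C₂| = 2 q² (q − 1) (q² − 1)²` -/

section Card

variable {F : Type*} [Field F]

/-- `det diag(t, 1) = t`. [folklore] -/
theorem det_diagonal_two (t : F) :
    (Matrix.diagonal ![t, 1] : Matrix (Fin 2) (Fin 2) F).det = t := by
  rw [Matrix.det_diagonal, Fin.prod_univ_two]
  simp

/-- `diag(t, 1) · diag(t⁻¹, 1) = 1` for `t ≠ 0`. [folklore] -/
theorem diagonal_two_mul_diagonal_two_inv {t : F} (ht : t ≠ 0) :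
    (Matrix.diagonal ![t, 1] : Matrix (Fin 2) (Fin 2) F) * Matrix.diagonal ![t⁻¹, 1] = 1 := by
  rw [Matrix.diagonal_mul_diagonal, ← Matrix.diagonal_one]
  congr 1
  funext i
  fin_cases i <;> simp [ht]

/-- `diag(t⁻¹, 1) · diag(t, 1) = 1` for `t ≠ 0`. [folklore] -/
theorem diagonal_two_inv_mul_diagonal_two {t : F} (ht : t ≠ 0) :
    (Matrix.diagonal ![t⁻¹, 1] : Matrix (Fin 2) (Fin 2) F) * Matrix.diagonal ![t, 1] = 1 := by
  rw [Matrix.diagonal_mul_diagonal, ← Matrix.diagonal_one]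
  congr 1
  funext i
  fin_cases i <;> simp [ht]

/-- `{a ∈ M₂(F) : det a ≠ 0} ≃ GL₂(F)` (Mathlib `Matrix.GeneralLinearGroup.mkOfDetNeZero`).
[folklore] -/
theorem natCard_det_ne_zero_eq_natCard_GL :
    Nat.card {a : Matrix (Fin 2) (Fin 2) F // a.det ≠ 0} = Nat.card (GL (Fin 2) F) := by
  refine Nat.card_congr
    { toFun := fun a => Matrix.GeneralLinearGroup.mkOfDetNeZero a.1 a.2
      invFun := fun g => ⟨g, Matrix.GeneralLinearGroup.det_ne_zero g⟩
      left_inv := fun a => Subtype.ext rfl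
      right_inv := fun g => Units.ext rfl }

variable [Fintype F] [DecidableEq F]

/-- **`{a ∈ M₂(F) : det a ≠ 0} ≃ Fˣ × SL₂(F)`**, `a ↦ (det a, diag(det a, 1)⁻¹ a)`; hence
`#{det ≠ 0} = (q − 1) · |SL₂(F)|`. [folklore] -/
theorem natCard_det_ne_zero_eq_mul :
    Nat.card {a : Matrix (Fin 2) (Fin 2) F // a.det ≠ 0} =
      (Fintype.card F - 1) * Nat.card (Matrix.SpecialLinearGroup (Fin 2) F) := by
  let e : {a : Matrix (Fin 2) (Fin 2) F // a.det ≠ 0} ≃ Fˣ × Matrix.SpecialLinearGroup (Fin 2) F :=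
    { toFun := fun a => (Units.mk0 a.1.det a.2,
        ⟨Matrix.diagonal ![a.1.det⁻¹, 1] * a.1, by
          rw [Matrix.det_mul, det_diagonal_two, inv_mul_cancel₀ a.2]⟩)
      invFun := fun x => ⟨Matrix.diagonal ![(x.1 : F), 1] * (x.2 : Matrix (Fin 2) (Fin 2) F), by
          rw [Matrix.det_mul, det_diagonal_two, x.2.det_coe, mul_one]
          exact x.1.ne_zero⟩
      left_inv := fun a => by
        apply Subtype.ext
        change Matrix.diagonal ![(a.1.det : F), 1] * (Matrix.diagonal ![a.1.det⁻¹, 1] * a.1) = a.1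
        rw [← mul_assoc, diagonal_two_mul_diagonal_two_inv a.2, one_mul]
      right_inv := fun x => by
        have hdet : (Matrix.diagonal ![(x.1 : F), 1] * (x.2 : Matrix (Fin 2) (Fin 2) F)).det = x.1 := by
          rw [Matrix.det_mul, det_diagonal_two, x.2.det_coe, mul_one]
        refine Prod.ext (Units.ext ?_) (Subtype.ext ?_)
        · exact hdet
        · change Matrix.diagonal ![(Matrix.diagonal ![(x.1 : F), 1] *
              (x.2 : Matrix (Fin 2) (Fin 2) F)).det⁻¹, 1] *
            (Matrix.diagonal ![(x.1 : F), 1] * (x.2 : Matrix (Fin 2) (Fin 2) F)) = x.2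
          rw [hdet, ← mul_assoc, diagonal_two_inv_mul_diagonal_two x.1.ne_zero, one_mul] }
  rw [Nat.card_congr e, Nat.card_prod, Nat.card_eq_fintype_card (α := Fˣ), Fintype.card_units]

/-- **`|SL₂(F_q)| = q (q² − 1)`**, from Mathlib's `|GL₂(F_q)| = (q² − 1)(q² − q)`
(`Matrix.card_GL_field`) and `|GL₂| = (q − 1) |SL₂|`. [folklore] -/
theorem natCard_specialLinearGroup_fin_two :
    Nat.card (Matrix.SpecialLinearGroup (Fin 2) F) = Fintype.card F * (Fintype.card F ^ 2 - 1) := by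
  set q := Fintype.card F with hq
  set s := Nat.card (Matrix.SpecialLinearGroup (Fin 2) F) with hs
  have hq1 : 1 < q := Fintype.one_lt_card
  have h := natCard_det_ne_zero_eq_mul (F := F)
  rw [natCard_det_ne_zero_eq_natCard_GL, Matrix.card_GL_field, Fin.prod_univ_two] at h
  simp only [Fin.val_zero, pow_zero, Fin.val_one, pow_one] at h
  -- `h : (q ^ 2 - 1) * (q ^ 2 - q) = (q - 1) * s`
  have h2 : q ^ 2 - q = q * (q - 1) := by rw [sq, Nat.mul_sub_one]
  rw [h2] at h
  have h3 : (q - 1) * s = (q - 1) * (q * (q ^ 2 - 1)) := by rw [← h]; ring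
  exact Nat.eq_of_mul_eq_mul_left (Nat.sub_pos_of_lt hq1) h3

/-- **`{(a, c) ∈ M₂(F)² : det a = det c ≠ 0} ≃ Fˣ × SL₂(F) × SL₂(F)`**; hence this set (the group
`Δ(F)`) has `(q − 1) |SL₂(F)|²` elements. [folklore] -/
theorem natCard_delta_eq_mul :
    Nat.card {ac : Matrix (Fin 2) (Fin 2) F × Matrix (Fin 2) (Fin 2) F //
        ac.1.det = ac.2.det ∧ ac.1.det ≠ 0} =
      (Fintype.card F - 1) * Nat.card (Matrix.SpecialLinearGroup (Fin 2) F) *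
        Nat.card (Matrix.SpecialLinearGroup (Fin 2) F) := by
  let e : {ac : Matrix (Fin 2) (Fin 2) F × Matrix (Fin 2) (Fin 2) F //
        ac.1.det = ac.2.det ∧ ac.1.det ≠ 0} ≃
      Fˣ × Matrix.SpecialLinearGroup (Fin 2) F × Matrix.SpecialLinearGroup (Fin 2) F :=
    { toFun := fun x => (Units.mk0 x.1.1.det x.2.2,
        ⟨Matrix.diagonal ![x.1.1.det⁻¹, 1] * x.1.1, by
          rw [Matrix.det_mul, det_diagonal_two, inv_mul_cancel₀ x.2.2]⟩,
        ⟨Matrix.diagonal ![x.1.1.det⁻¹, 1] * x.1.2, by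
          rw [Matrix.det_mul, det_diagonal_two, ← x.2.1, inv_mul_cancel₀ x.2.2]⟩)
      invFun := fun y => ⟨(Matrix.diagonal ![(y.1 : F), 1] * (y.2.1 : Matrix (Fin 2) (Fin 2) F),
          Matrix.diagonal ![(y.1 : F), 1] * (y.2.2 : Matrix (Fin 2) (Fin 2) F)), by
          refine ⟨?_, ?_⟩
          · change (Matrix.diagonal ![(y.1 : F), 1] * (y.2.1 : Matrix (Fin 2) (Fin 2) F)).det =
              (Matrix.diagonal ![(y.1 : F), 1] * (y.2.2 : Matrix (Fin 2) (Fin 2) F)).det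
            rw [Matrix.det_mul, Matrix.det_mul, y.2.1.det_coe, y.2.2.det_coe]
          · change (Matrix.diagonal ![(y.1 : F), 1] * (y.2.1 : Matrix (Fin 2) (Fin 2) F)).det ≠ 0
            rw [Matrix.det_mul, det_diagonal_two, y.2.1.det_coe, mul_one]
            exact y.1.ne_zero⟩
      left_inv := fun x => by
        apply Subtype.ext
        apply Prod.ext
        · change Matrix.diagonal ![(x.1.1.det : F), 1] * (Matrix.diagonal ![x.1.1.det⁻¹, 1] * x.1.1) =
            x.1.1
          rw [← mul_assoc, diagonal_two_mul_diagonal_two_inv x.2.2, one_mul]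
        · change Matrix.diagonal ![(x.1.1.det : F), 1] * (Matrix.diagonal ![x.1.1.det⁻¹, 1] * x.1.2) =
            x.1.2
          rw [← mul_assoc, diagonal_two_mul_diagonal_two_inv x.2.2, one_mul]
      right_inv := fun y => by
        have hdet : (Matrix.diagonal ![(y.1 : F), 1] * (y.2.1 : Matrix (Fin 2) (Fin 2) F)).det = y.1 := by
          rw [Matrix.det_mul, det_diagonal_two, y.2.1.det_coe, mul_one]
        refine Prod.ext (Units.ext hdet) (Prod.ext (Subtype.ext ?_) (Subtype.ext ?_))
        · change Matrix.diagonal ![(Matrix.diagonal ![(y.1 : F), 1] *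
              (y.2.1 : Matrix (Fin 2) (Fin 2) F)).det⁻¹, 1] *
            (Matrix.diagonal ![(y.1 : F), 1] * (y.2.1 : Matrix (Fin 2) (Fin 2) F)) = y.2.1
          rw [hdet, ← mul_assoc, diagonal_two_inv_mul_diagonal_two y.1.ne_zero, one_mul]
        · change Matrix.diagonal ![(Matrix.diagonal ![(y.1 : F), 1] *
              (y.2.1 : Matrix (Fin 2) (Fin 2) F)).det⁻¹, 1] *
            (Matrix.diagonal ![(y.1 : F), 1] * (y.2.2 : Matrix (Fin 2) (Fin 2) F)) = y.2.2
          rw [hdet, ← mul_assoc, diagonal_two_inv_mul_diagonal_two y.1.ne_zero, one_mul] }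
  rw [Nat.card_congr e, Nat.card_prod, Nat.card_prod, Nat.card_eq_fintype_card (α := Fˣ),
    Fintype.card_units, mul_assoc]

variable {k : Type*} [Field k] (ι : F →+* k)

/-- **`|Δ(F) ⋊ C₂| = 2 q² (q − 1) (q² − 1)²`.**  The set of block matrices `diag(ι a, ι c)` and
`antidiag(ι a, ι c)` in `M₄(k)` with `a, c ∈ M₂(F)`, `det a = det c ≠ 0` — the group
`Δ(F) ⋊ C₂`, `Δ(F) = {(a, c) ∈ GL₂(F)² : det a = det c}`, embedded in `GL₄(k)` through
`ι : F → k` — has exactly `2 q² (q − 1) (q² − 1)²` elements, `q = |F|`. [folklore] -/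
theorem natCard_wreath_setOf :
    Nat.card {M : Matrix (Fin 4) (Fin 4) k | ∃ a c : Matrix (Fin 2) (Fin 2) F,
        a.det = c.det ∧ a.det ≠ 0 ∧
        (M = Matrix.reindex finSumFinEquiv finSumFinEquiv
            (Matrix.fromBlocks (a.map ι) 0 0 (c.map ι)) ∨
         M = Matrix.reindex finSumFinEquiv finSumFinEquiv
            (Matrix.fromBlocks 0 (a.map ι) (c.map ι) 0))} =
      2 * Fintype.card F ^ 2 * (Fintype.card F - 1) * (Fintype.card F ^ 2 - 1) ^ 2 := by
  set T := {ac : Matrix (Fin 2) (Fin 2) F × Matrix (Fin 2) (Fin 2) F //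
      ac.1.det = ac.2.det ∧ ac.1.det ≠ 0} with hT
  let f : T × Bool → Matrix (Fin 4) (Fin 4) k := fun x =>
    cond x.2
      (Matrix.reindex finSumFinEquiv finSumFinEquiv
        (Matrix.fromBlocks 0 (x.1.1.1.map ι) (x.1.1.2.map ι) 0))
      (Matrix.reindex finSumFinEquiv finSumFinEquiv
        (Matrix.fromBlocks (x.1.1.1.map ι) 0 0 (x.1.1.2.map ι)))
  have hmapι : Function.Injective fun M : Matrix (Fin 2) (Fin 2) F => M.map ι :=
    Matrix.map_injective ι.injective
  have hzero : ∀ a : Matrix (Fin 2) (Fin 2) F, a.det ≠ 0 → a.map ι ≠ 0 := by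
    intro a ha h
    apply ha
    have h0 : a = 0 := hmapι (h.trans (Matrix.map_zero ι (map_zero ι)).symm)
    rw [h0, Matrix.det_zero]
  have hrange : Set.range f = {M : Matrix (Fin 4) (Fin 4) k | ∃ a c : Matrix (Fin 2) (Fin 2) F,
        a.det = c.det ∧ a.det ≠ 0 ∧
        (M = Matrix.reindex finSumFinEquiv finSumFinEquiv
            (Matrix.fromBlocks (a.map ι) 0 0 (c.map ι)) ∨
         M = Matrix.reindex finSumFinEquiv finSumFinEquiv
            (Matrix.fromBlocks 0 (a.map ι) (c.map ι) 0))} := by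
    ext M
    constructor
    · rintro ⟨⟨⟨⟨a, c⟩, hdet, hne⟩, b⟩, rfl⟩
      cases b
      · exact ⟨a, c, hdet, hne, Or.inl rfl⟩
      · exact ⟨a, c, hdet, hne, Or.inr rfl⟩
    · rintro ⟨a, c, hdet, hne, h | h⟩
      · exact ⟨(⟨(a, c), hdet, hne⟩, false), h.symm⟩
      · exact ⟨(⟨(a, c), hdet, hne⟩, true), h.symm⟩
  have hinj : Function.Injective f := by
    rintro ⟨⟨⟨a, c⟩, hdet, hne⟩, b⟩ ⟨⟨⟨a', c'⟩, hdet', hne'⟩, b'⟩ h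
    cases b <;> cases b'
    · obtain ⟨h1, -, -, h4⟩ := reindex_fromBlocks_inj h
      obtain rfl : a = a' := hmapι h1
      obtain rfl : c = c' := hmapι h4
      rfl
    · obtain ⟨h1, -, -, -⟩ := reindex_fromBlocks_inj h
      exact absurd h1 (hzero a hne)
    · obtain ⟨h1, -, -, -⟩ := reindex_fromBlocks_inj h
      exact absurd h1.symm (hzero a' hne')
    · obtain ⟨-, h2, h3, -⟩ := reindex_fromBlocks_inj h
      obtain rfl : a = a' := hmapι h2
      obtain rfl : c = c' := hmapι h3
      rfl
  rw [← hrange, Nat.card_range_of_injective hinj, Nat.card_prod, natCard_delta_eq_mul,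
    natCard_specialLinearGroup_fin_two]
  simp only [Nat.card_eq_fintype_card, Fintype.card_bool]
  ring

end Card

end SL2Wreath

/-! ### Framed Galois representations with wreath-product image -/

section Galois

open Field

variable {K : Type*} [Field K] {A : Type*} [Field A] [TopologicalSpace A] [IsTopologicalRing A]
  {n : ℕ}

/-- A framed Galois representation whose restriction to `Γ_L` (`L/K` any extension, along the
tree's `absGaloisRestrict K L`) is irreducible is irreducible. [folklore] -/
theorem _root_.Literature.NumberTheory.GaloisRepresentations.FramedGaloisRep.isIrreducible_of_restrictField
    (L : Type*) [Field L] [Algebra K L] (ρ : FramedGaloisRep K A n)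
    (h : (ρ.restrictField L).toGaloisRep.IsIrreducible) : ρ.toGaloisRep.IsIrreducible :=
  Literature.RepresentationTheory.Semisimple.Representation.isIrreducible_of_isIrreducible_comp
    ρ.toRepresentation (absGaloisRestrict K L).toMonoidHom h

variable {p : ℕ} [Fact p.Prime] {k : Type*} [Field k] [CharP k p] [TopologicalSpace k]
  [IsTopologicalRing k]

omit [TopologicalSpace k] [IsTopologicalRing k] in
/-- `2 ≠ 0` in a field of odd prime characteristic `p`. [folklore] -/
theorem two_ne_zero_of_charP_of_ne_two (hp2 : p ≠ 2) : (2 : k) ≠ 0 := by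
  intro h
  have hdvd : p ∣ 2 := (CharP.cast_eq_zero_iff k p 2).1 (by exact_mod_cast h)
  exact hp2 ((Nat.prime_dvd_prime_iff_eq (Fact.out : p.Prime) Nat.prime_two).1 hdvd)

/-- **Irreducibility over `ℚ(ζ_p)`.**  Let `ρ̄ : Γ_ℚ → GL₄(k)`, `char k = p` odd, and suppose that
in some frame `g` the image of `Γ_{ℚ(ζ_{p^∞})} = ker χ_p` is the wreath product
`SL₂(𝔽_p) ≀ C₂` (block-diagonal and block-antidiagonal matrices with blocks in `SL₂(𝔽_p)`).
Then `ρ̄|_{Γ_{ℚ(ζ_p)}}` is irreducible: `Γ_{ℚ(ζ_p)} ⊇ ker χ_p`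
(`mem_range_absGaloisRestrict_of_modPCyclotomicCharacterZMod_eq_one`,
`toZMod_cyclotomicCharacter_apply`), and the `k`-span of `SL₂(𝔽_p) ≀ C₂` is all of `M₄(k)`
(`SL2Wreath.span_wreath_eq_top`), so a stable subspace is stable under every matrix
(`isIrreducible_of_span_eq_top`).  This is the verification, in the proof of Lemma 10.4.1 of
Boxer–Calegari–Gee–Pilloni (arXiv:2502.20645, p. 146: "`ρ̄_{A,p}(G_{ℚ(ζ_{p^∞})}) =
SL₂(𝔽_p) ≀ ℤ/2ℤ`"), that the residual representation is irreducible on `G_{ℚ(ζ_p)}`.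
[cite: BoxerCalegariGeePilloni2025, proof of Lemma 10.4.1 (p. 146)] -/
theorem isIrreducible_restrictField_cyclotomicField_of_image_ker_cyclotomic (hp2 : p ≠ 2)
    (ρb : FramedGaloisRep ℚ k 4) (g : GL (Fin 4) k)
    (hSL : (fun τ : absoluteGaloisGroup ℚ =>
        ((g * ρb τ * g⁻¹ : GL (Fin 4) k) : Matrix (Fin 4) (Fin 4) k)) ''
          {τ | GaloisRep.cyclotomicCharacter ℚ p τ = 1} =
      {M | ∃ a c : Matrix (Fin 2) (Fin 2) (ZMod p), a.det = 1 ∧ c.det = 1 ∧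
        (M = Matrix.reindex finSumFinEquiv finSumFinEquiv
            (Matrix.fromBlocks (a.map (ZMod.castHom (dvd_refl p) k)) 0 0
              (c.map (ZMod.castHom (dvd_refl p) k))) ∨
         M = Matrix.reindex finSumFinEquiv finSumFinEquiv
            (Matrix.fromBlocks 0 (a.map (ZMod.castHom (dvd_refl p) k))
              (c.map (ZMod.castHom (dvd_refl p) k)) 0))}) :
    (ρb.restrictField (CyclotomicField p ℚ)).toGaloisRep.IsIrreducible := by
  haveI : NeZero ((p : ℕ) : ℚ) := ⟨Nat.cast_ne_zero.2 (Fact.out : p.Prime).ne_zero⟩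
  set L := CyclotomicField p ℚ with hL
  haveI : IsCyclotomicExtension {p} ℚ L := CyclotomicField.isCyclotomicExtension p ℚ
  change Representation.IsIrreducible
    ((glStdRepresentation (Fin 4) k).comp (ρb.restrictField L).toMonoidHom)
  refine Literature.RepresentationTheory.Semisimple.isIrreducible_of_span_eq_top (by norm_num)
    (ρb.restrictField L).toMonoidHom ?_
  set Tsp := Submodule.span k (Set.range fun σ : absoluteGaloisGroup L =>
      (((ρb.restrictField L).toMonoidHom σ : GL (Fin 4) k) : Matrix (Fin 4) (Fin 4) k)) with hTsp
  -- conjugation `M ↦ g⁻¹ M g` as a linear map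
  let C : Matrix (Fin 4) (Fin 4) k →ₗ[k] Matrix (Fin 4) (Fin 4) k :=
    { toFun := fun M => ((g⁻¹ : GL (Fin 4) k) : Matrix (Fin 4) (Fin 4) k) * M *
        (g : Matrix (Fin 4) (Fin 4) k)
      map_add' := fun M N => by rw [Matrix.mul_add, Matrix.add_mul]
      map_smul' := fun c M => by rw [RingHom.id_apply, Matrix.mul_smul, Matrix.smul_mul] }
  -- every element of the image of `ker χ_p` conjugates back into `Tsp`
  have hC : ∀ τ ∈ {τ : absoluteGaloisGroup ℚ | GaloisRep.cyclotomicCharacter ℚ p τ = 1},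
      C ((g * ρb τ * g⁻¹ : GL (Fin 4) k) : Matrix (Fin 4) (Fin 4) k) ∈ Tsp := by
    intro τ hτ
    rw [Set.mem_setOf_eq] at hτ
    have hτ' : modPCyclotomicCharacterZMod ℚ p τ = 1 := by
      apply Units.ext
      rw [← toZMod_cyclotomicCharacter_apply, hτ, Units.val_one, Units.val_one, map_one]
    obtain ⟨σ, hσ⟩ := MonoidHom.mem_range.1
      (mem_range_absGaloisRestrict_of_modPCyclotomicCharacterZMod_eq_one ℚ p L hτ')
    refine Submodule.subset_span ⟨σ, ?_⟩
    change ((ρb (absGaloisRestrict ℚ L σ) : GL (Fin 4) k) : Matrix (Fin 4) (Fin 4) k) =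
      ((g⁻¹ : GL (Fin 4) k) : Matrix (Fin 4) (Fin 4) k) *
        ((g * ρb τ * g⁻¹ : GL (Fin 4) k) : Matrix (Fin 4) (Fin 4) k) * (g : Matrix (Fin 4) (Fin 4) k)
    have hσ' : absGaloisRestrict ℚ L σ = τ := hσ
    rw [hσ', ← Units.val_mul, ← Units.val_mul]
    congr 1
    group
  have hle : Submodule.span k ((fun τ : absoluteGaloisGroup ℚ =>
        ((g * ρb τ * g⁻¹ : GL (Fin 4) k) : Matrix (Fin 4) (Fin 4) k)) ''
          {τ | GaloisRep.cyclotomicCharacter ℚ p τ = 1}) ≤ Tsp.comap C := by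
    refine Submodule.span_le.2 ?_
    rintro _ ⟨τ, hτ, rfl⟩
    exact hC τ hτ
  rw [hSL, SL2Wreath.span_wreath_eq_top (ZMod.castHom (dvd_refl p) k)
    (two_ne_zero_of_charP_of_ne_two hp2)] at hle
  rw [eq_top_iff]
  rintro M -
  have hM : C ((g : Matrix (Fin 4) (Fin 4) k) * M * ((g⁻¹ : GL (Fin 4) k) : Matrix (Fin 4) (Fin 4) k)) =
      M := by
    change ((g⁻¹ : GL (Fin 4) k) : Matrix (Fin 4) (Fin 4) k) *
        ((g : Matrix (Fin 4) (Fin 4) k) * M * ((g⁻¹ : GL (Fin 4) k) : Matrix (Fin 4) (Fin 4) k)) *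
        (g : Matrix (Fin 4) (Fin 4) k) = M
    simp only [← Matrix.mul_assoc, Units.inv_mul, Matrix.one_mul]
    rw [Matrix.mul_assoc, Units.inv_mul, Matrix.mul_one]
  rw [← hM]
  exact hle Submodule.mem_top

/-- **Irreducibility over `ℚ`** under the same hypothesis (restriction to `Γ_{ℚ(ζ_p)}`).
[cite: BoxerCalegariGeePilloni2025, proof of Lemma 10.4.1 (p. 146)] -/
theorem isIrreducible_of_image_ker_cyclotomic (hp2 : p ≠ 2)
    (ρb : FramedGaloisRep ℚ k 4) (g : GL (Fin 4) k)
    (hSL : (fun τ : absoluteGaloisGroup ℚ =>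
        ((g * ρb τ * g⁻¹ : GL (Fin 4) k) : Matrix (Fin 4) (Fin 4) k)) ''
          {τ | GaloisRep.cyclotomicCharacter ℚ p τ = 1} =
      {M | ∃ a c : Matrix (Fin 2) (Fin 2) (ZMod p), a.det = 1 ∧ c.det = 1 ∧
        (M = Matrix.reindex finSumFinEquiv finSumFinEquiv
            (Matrix.fromBlocks (a.map (ZMod.castHom (dvd_refl p) k)) 0 0
              (c.map (ZMod.castHom (dvd_refl p) k))) ∨
         M = Matrix.reindex finSumFinEquiv finSumFinEquiv
            (Matrix.fromBlocks 0 (a.map (ZMod.castHom (dvd_refl p) k))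
              (c.map (ZMod.castHom (dvd_refl p) k)) 0))}) :
    ρb.toGaloisRep.IsIrreducible :=
  ρb.isIrreducible_of_restrictField (CyclotomicField p ℚ)
    (isIrreducible_restrictField_cyclotomicField_of_image_ker_cyclotomic hp2 ρb g hSL)

omit [CharP k p] in
/-- **Reducibility over the quadratic field.**  If in some frame `g` the image of `Γ_K` (along
`absGaloisRestrict ℚ K`) consists of block-diagonal matrices, then `ρ̄|_{Γ_K}` is reducible:
`g⁻¹ (k e₀ ⊕ k e₁)` is a stable plane.  (For `ρ̄_{A,p}`, `A` of type **B**[C₂] and `K` its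
quadratic field, `ρ̄_{A,p}(G_K) = Δ_p ⊆ GL₂(𝔽_p) × GL₂(𝔽_p)`, proof of Lemma 10.4.1, p. 146.)
[cite: BoxerCalegariGeePilloni2025, proof of Lemma 10.4.1 (p. 146)] -/
theorem not_isIrreducible_restrictField_of_range_blockDiagonal {F : Type*} [CommRing F]
    (ι : F →+* k) (ρb : FramedGaloisRep ℚ k 4) (g : GL (Fin 4) k)
    (K : Type*) [Field K] [Algebra ℚ K]
    (hK : Set.range (fun τ : absoluteGaloisGroup K =>
        ((g * ρb (absGaloisRestrict ℚ K τ) * g⁻¹ : GL (Fin 4) k) : Matrix (Fin 4) (Fin 4) k)) =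
      {M | ∃ a c : Matrix (Fin 2) (Fin 2) F, a.det = c.det ∧ a.det ≠ 0 ∧
        M = Matrix.reindex finSumFinEquiv finSumFinEquiv
            (Matrix.fromBlocks (a.map ι) 0 0 (c.map ι))}) :
    ¬ (ρb.restrictField K).toGaloisRep.IsIrreducible := by
  intro hirr
  change Representation.IsIrreducible (ρb.restrictField K).toRepresentation at hirr
  -- the plane `g⁻¹ (k e₀ ⊕ k e₁)`
  let V₀ : Submodule k (Fin 4 → k) :=
    LinearMap.ker (LinearMap.proj 2) ⊓ LinearMap.ker (LinearMap.proj 3)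
  have hmem : ∀ v : Fin 4 → k,
      v ∈ V₀.comap (Matrix.mulVecLin (g : Matrix (Fin 4) (Fin 4) k)) ↔
        ((g : Matrix (Fin 4) (Fin 4) k) *ᵥ v) 2 = 0 ∧ ((g : Matrix (Fin 4) (Fin 4) k) *ᵥ v) 3 = 0 := by
    intro v
    simp [V₀]
  let W : Subrepresentation (ρb.restrictField K).toRepresentation :=
    ⟨V₀.comap (Matrix.mulVecLin (g : Matrix (Fin 4) (Fin 4) k)), fun τ v hv => by
      obtain ⟨a, c, -, -, hB⟩ :
          ((g * ρb (absGaloisRestrict ℚ K τ) * g⁻¹ : GL (Fin 4) k) : Matrix (Fin 4) (Fin 4) k) ∈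
            {M | ∃ a c : Matrix (Fin 2) (Fin 2) F, a.det = c.det ∧ a.det ≠ 0 ∧
              M = Matrix.reindex finSumFinEquiv finSumFinEquiv
                (Matrix.fromBlocks (a.map ι) 0 0 (c.map ι))} := by
        rw [← hK]
        exact ⟨τ, rfl⟩
      rw [hmem] at hv ⊢
      rw [FramedRep.toRepresentation_apply_apply, FramedGaloisRep.restrictField_apply,
        Matrix.mulVec_mulVec]
      have hmul : (g : Matrix (Fin 4) (Fin 4) k) *
          ((ρb (absGaloisRestrict ℚ K τ) : GL (Fin 4) k) : Matrix (Fin 4) (Fin 4) k) =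
          ((g * ρb (absGaloisRestrict ℚ K τ) * g⁻¹ : GL (Fin 4) k) : Matrix (Fin 4) (Fin 4) k) *
            (g : Matrix (Fin 4) (Fin 4) k) := by
        rw [← Units.val_mul, ← Units.val_mul]
        congr 1
        group
      rw [hmul, ← Matrix.mulVec_mulVec, SL2Wreath.mulVec_apply_two_of_eq_fromBlocks hB,
        SL2Wreath.mulVec_apply_three_of_eq_fromBlocks hB, hv.1, hv.2]
      simp⟩
  have hbot : (⊥ : Subrepresentation (ρb.restrictField K).toRepresentation).toSubmodule = ⊥ := rfl
  have htop : (⊤ : Subrepresentation (ρb.restrictField K).toRepresentation).toSubmodule = ⊤ := rfl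
  have hginv : ∀ v : Fin 4 → k, (g : Matrix (Fin 4) (Fin 4) k) *ᵥ
      (((g⁻¹ : GL (Fin 4) k) : Matrix (Fin 4) (Fin 4) k) *ᵥ v) = v := fun v => by
    rw [Matrix.mulVec_mulVec, Units.mul_inv, Matrix.one_mulVec]
  rcases hirr.eq_bot_or_eq_top W with h | h
  · -- `g⁻¹ e₀ ∈ W` is non-zero
    have hW : ((g⁻¹ : GL (Fin 4) k) : Matrix (Fin 4) (Fin 4) k) *ᵥ Pi.single 0 1 ∈ W.toSubmodule := by
      change _ ∈ V₀.comap (Matrix.mulVecLin (g : Matrix (Fin 4) (Fin 4) k))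
      rw [hmem, hginv]
      simp
    rw [h, hbot, Submodule.mem_bot] at hW
    have h0 := congrArg (fun v => ((g : Matrix (Fin 4) (Fin 4) k) *ᵥ v) 0) hW
    simp only [hginv, Matrix.mulVec_zero] at h0
    simp at h0
  · -- `g⁻¹ e₂ ∉ W`
    have hW : ((g⁻¹ : GL (Fin 4) k) : Matrix (Fin 4) (Fin 4) k) *ᵥ Pi.single 2 1 ∈ W.toSubmodule := by
      rw [h, htop]
      exact Submodule.mem_top
    change _ ∈ V₀.comap (Matrix.mulVecLin (g : Matrix (Fin 4) (Fin 4) k)) at hW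
    rw [hmem, hginv] at hW
    simp at hW

omit [IsTopologicalRing k] in
/-- **Order of the image.**  If in some frame the image of `ρ̄ : Γ_ℚ → GL₄(k)` is
`Δ_p ⋊ C₂ = {diag(a, c), antidiag(a, c) : a, c ∈ GL₂(𝔽_p), det a = det c}`, then
`|ρ̄(Γ_ℚ)| = 2 p² (p − 1) (p² − 1)²` (`SL2Wreath.natCard_wreath_setOf`; for `ρ̄_{A,p}`, `A` of
type **B**[C₂]: `ρ̄_{A,p}(G_K) = Δ_p` of index `2` in the image, proof of Lemma 10.4.1, p. 146).
[cite: BoxerCalegariGeePilloni2025, proof of Lemma 10.4.1 (p. 146)] -/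
theorem natCard_range_of_range_eq_wreath (ρb : FramedGaloisRep ℚ k 4) (g : GL (Fin 4) k)
    (hGL : Set.range (fun τ : absoluteGaloisGroup ℚ =>
        ((g * ρb τ * g⁻¹ : GL (Fin 4) k) : Matrix (Fin 4) (Fin 4) k)) =
      {M | ∃ a c : Matrix (Fin 2) (Fin 2) (ZMod p), a.det = c.det ∧ a.det ≠ 0 ∧
        (M = Matrix.reindex finSumFinEquiv finSumFinEquiv
            (Matrix.fromBlocks (a.map (ZMod.castHom (dvd_refl p) k)) 0 0
              (c.map (ZMod.castHom (dvd_refl p) k))) ∨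
         M = Matrix.reindex finSumFinEquiv finSumFinEquiv
            (Matrix.fromBlocks 0 (a.map (ZMod.castHom (dvd_refl p) k))
              (c.map (ZMod.castHom (dvd_refl p) k)) 0))}) :
    Nat.card ρb.toMonoidHom.range = 2 * p ^ 2 * (p - 1) * (p ^ 2 - 1) ^ 2 := by
  have hF : Function.Injective fun x : GL (Fin 4) k =>
      ((g * x * g⁻¹ : GL (Fin 4) k) : Matrix (Fin 4) (Fin 4) k) := by
    intro x y h
    have h' : g * x * g⁻¹ = g * y * g⁻¹ := Units.ext h
    exact mul_left_cancel (mul_right_cancel h')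
  have h1 : Nat.card ρb.toMonoidHom.range = Nat.card (Set.range (ρb : absoluteGaloisGroup ℚ → GL (Fin 4) k)) := by
    rw [← SetLike.coe_sort_coe, MonoidHom.coe_range]
    rfl
  rw [h1, ← Nat.card_image_of_injective hF, ← Set.range_comp]
  change Nat.card (Set.range fun τ : absoluteGaloisGroup ℚ =>
    ((g * ρb τ * g⁻¹ : GL (Fin 4) k) : Matrix (Fin 4) (Fin 4) k)) = _
  rw [hGL, SL2Wreath.natCard_wreath_setOf, ZMod.card p]

/-- **The four residue conditions of the Serre hypothesis from the images of p. 146.**  Let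
`ρ̄ : Γ_ℚ → GL₄(k)`, `char k = p` an odd prime, `K` a quadratic field, and suppose that in some
frame `g`: `ρ̄(Γ_ℚ) = Δ_p ⋊ ⟨w⟩`, `ρ̄(Γ_K) = Δ_p` and `ρ̄(ker χ_p) = SL₂(𝔽_p) ≀ ℤ/2`
(`Δ_p = {(a, c) ∈ GL₂(𝔽_p)² : det a = det c}` block-diagonally, `w` the block swap) — the
images computed for `ρ̄_{A,p}`, `A/ℚ` an abelian surface of type **B**[C₂], at the good primes of
the proof of BCGP 2025, Lemma 10.4.1 (p. 146, from [BoxerEtAl2021, §9.2]).  Then `ρ̄` is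
irreducible, `|ρ̄(Γ_ℚ)| = 2 p² (p − 1) (p² − 1)²`, `ρ̄|_{Γ_{ℚ(ζ_p)}}` is irreducible and
`ρ̄|_{Γ_K}` is reducible — i.e. `ρ̄` is one of the wreath residues at which the hypothesis of
`Literature.NumberTheory.DiophantineGeometry.bcgp_serreWreathFixedSimilitude_implies_quadraticImprimitiveSurfacesModular`
(Serre's conjecture for `GSp₄` in regular ordinary weight, wreath residues) is stated; this is the
sentence "so `ρ̄_{A,p}` satisfies the hypotheses of [the conjecture]" of that proof, made
explicit.  The three image clauses are VERBATIM those of the binder `hgood` of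
`bcgp_serreWreathFixedSimilitude_implies_quadraticImprimitiveSurfacesModular_of_modularityLifting_of_goodPrimes_of_remainingTypes`
(`BcgpSerreWreathFixedSimilitudeImprimitiveSurfacesProofs.lean`), and the conclusion is verbatim
its last four conjuncts. [cite: BoxerCalegariGeePilloni2025, proof of Lemma 10.4.1 (p. 146)]
[cite: BoxerEtAl2021, §9.2 (Lemma 9.2.2, Lemma 9.2.5)] -/
theorem serreWreathResidueConditions_of_images (hp2 : p ≠ 2) (ρb : FramedGaloisRep ℚ k 4)
    (K : Type) [Field K] [NumberField K] (hK2 : Module.finrank ℚ K = 2)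
    (himg : ∃ g : GL (Fin 4) k,
      Set.range (fun τ : absoluteGaloisGroup ℚ =>
          ((g * ρb τ * g⁻¹ : GL (Fin 4) k) : Matrix (Fin 4) (Fin 4) k)) =
        {M | ∃ a c : Matrix (Fin 2) (Fin 2) (ZMod p), a.det = c.det ∧ a.det ≠ 0 ∧
          (M = Matrix.reindex finSumFinEquiv finSumFinEquiv
              (Matrix.fromBlocks (a.map (ZMod.castHom (dvd_refl p) k)) 0 0
                (c.map (ZMod.castHom (dvd_refl p) k))) ∨
           M = Matrix.reindex finSumFinEquiv finSumFinEquiv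
              (Matrix.fromBlocks 0 (a.map (ZMod.castHom (dvd_refl p) k))
                (c.map (ZMod.castHom (dvd_refl p) k)) 0))} ∧
      Set.range (fun τ : absoluteGaloisGroup K =>
          ((g * ρb (absGaloisRestrict ℚ K τ) * g⁻¹ : GL (Fin 4) k) : Matrix (Fin 4) (Fin 4) k)) =
        {M | ∃ a c : Matrix (Fin 2) (Fin 2) (ZMod p), a.det = c.det ∧ a.det ≠ 0 ∧
          M = Matrix.reindex finSumFinEquiv finSumFinEquiv
              (Matrix.fromBlocks (a.map (ZMod.castHom (dvd_refl p) k)) 0 0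
                (c.map (ZMod.castHom (dvd_refl p) k)))} ∧
      (fun τ : absoluteGaloisGroup ℚ =>
          ((g * ρb τ * g⁻¹ : GL (Fin 4) k) : Matrix (Fin 4) (Fin 4) k)) ''
          {τ | GaloisRep.cyclotomicCharacter ℚ p τ = 1} =
        {M | ∃ a c : Matrix (Fin 2) (Fin 2) (ZMod p), a.det = 1 ∧ c.det = 1 ∧
          (M = Matrix.reindex finSumFinEquiv finSumFinEquiv
              (Matrix.fromBlocks (a.map (ZMod.castHom (dvd_refl p) k)) 0 0
                (c.map (ZMod.castHom (dvd_refl p) k))) ∨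
           M = Matrix.reindex finSumFinEquiv finSumFinEquiv
              (Matrix.fromBlocks 0 (a.map (ZMod.castHom (dvd_refl p) k))
                (c.map (ZMod.castHom (dvd_refl p) k)) 0))}) :
    ρb.toGaloisRep.IsIrreducible ∧
    Nat.card ρb.toMonoidHom.range = 2 * p ^ 2 * (p - 1) * (p ^ 2 - 1) ^ 2 ∧
    (ρb.restrictField (CyclotomicField p ℚ)).toGaloisRep.IsIrreducible ∧
    (∃ (K' : Type) (_ : Field K') (_ : NumberField K'), Module.finrank ℚ K' = 2 ∧
      ¬ (ρb.restrictField K').toGaloisRep.IsIrreducible) := by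
  obtain ⟨g, hGL, hK, hSL⟩ := himg
  exact ⟨isIrreducible_of_image_ker_cyclotomic hp2 ρb g hSL,
    natCard_range_of_range_eq_wreath ρb g hGL,
    isIrreducible_restrictField_cyclotomicField_of_image_ker_cyclotomic hp2 ρb g hSL,
    K, inferInstance, inferInstance, hK2,
    not_isIrreducible_restrictField_of_range_blockDiagonal (ZMod.castHom (dvd_refl p) k) ρb g K hK⟩

end Galois

/-! ### The image of `Γ_ℚ` from the images of `Γ_K` and of `ker χ_p` (p. 146: "`G_K ↠ Δ_p`",
"`ρ̄(G_{ℚ(ζ_{p^∞})}) = SL₂(𝔽_p) ≀ ℤ/2ℤ`" ⟹ `ρ̄(G_ℚ) = Δ_p ⋊ C₂`) -/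

namespace SL2Wreath

section Mul

variable {k : Type*} [CommRing k]

/-- Products of `2 + 2` block matrices reindexed to `Fin 4`. [folklore] -/
theorem reindex_mul_reindex (P Q : Matrix (Fin 2 ⊕ Fin 2) (Fin 2 ⊕ Fin 2) k) :
    Matrix.reindex finSumFinEquiv finSumFinEquiv P * Matrix.reindex finSumFinEquiv finSumFinEquiv Q =
      Matrix.reindex finSumFinEquiv finSumFinEquiv (P * Q) := by
  rw [Matrix.reindex_apply, Matrix.reindex_apply, Matrix.reindex_apply]
  exact Matrix.submatrix_mul_equiv P Q _ finSumFinEquiv.symm _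

/-- `antidiag(B, C) · diag(A', D') = antidiag(B D', C A')` (stated for matrices
`M N : Matrix (Fin 4) (Fin 4) k` EQUAL to the block matrices). [folklore] -/
theorem mul_eq_of_eq_antidiag_of_eq_diag {M N : Matrix (Fin 4) (Fin 4) k}
    {B C A' D' : Matrix (Fin 2) (Fin 2) k}
    (hM : M = Matrix.reindex finSumFinEquiv finSumFinEquiv (Matrix.fromBlocks 0 B C 0))
    (hN : N = Matrix.reindex finSumFinEquiv finSumFinEquiv (Matrix.fromBlocks A' 0 0 D')) :
    M * N = Matrix.reindex finSumFinEquiv finSumFinEquiv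
      (Matrix.fromBlocks 0 (B * D') (C * A') 0) := by
  subst hM hN
  rw [reindex_mul_reindex, Matrix.fromBlocks_multiply]
  simp

end Mul

section MapZero

variable {F : Type*} [Field F] {k : Type*} [Field k] (ι : F →+* k)

/-- A square matrix over a field killed entrywise by a field homomorphism is `0`, so has
determinant `0`. [folklore] -/
theorem det_eq_zero_of_map_eq_zero {a : Matrix (Fin 2) (Fin 2) F} (h : a.map ι = 0) :
    a.det = 0 := by
  have h0 : a = 0 :=
    Matrix.map_injective ι.injective (h.trans (Matrix.map_zero ι (map_zero ι)).symm)
  rw [h0, Matrix.det_zero]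

end MapZero

end SL2Wreath

section GaloisImage

open Field

/-- **`[Γ_ℚ-side : res(Γ_M)] = [M : K]`** for a finite extension `M/K` of fields of
characteristic `0`: the image of `Γ_M → Γ_K` is the fixing subgroup of the copy `e(M) ⊆ K̄`
(`exists_mem_range_absGaloisRestrict_iff`), of index `[e(M) : K]`
(`IntermediateField.finrank_eq_fixingSubgroup_index`).  Re-derived verbatim from
`index_range_absGaloisRestrict_eq_finrank` (`ArtinFormalismInductionProofs.lean`) to keep this
file free of the Artin `L`-function imports. [folklore] -/
theorem index_range_absGaloisRestrict_eq_finrank' (K : Type*) (M : Type*) [Field K] [Field M]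
    [Algebra K M] [FiniteDimensional K M] [CharZero K] :
    (absGaloisRestrict K M).range.index = Module.finrank K M := by
  obtain ⟨e, he⟩ := exists_mem_range_absGaloisRestrict_iff K M
  have hK' : (absGaloisRestrict K M).range =
      (e.fieldRange.fixingSubgroup : Subgroup (absoluteGaloisGroup K)) := by
    ext g
    refine (he g).trans (Iff.trans ?_ (mem_fixingSubgroup_iff_forall_smul e.fieldRange g).symm)
    constructor
    · rintro h ⟨x, ⟨y, rfl⟩⟩
      exact h y
    · intro h y
      exact h ⟨e y, ⟨y, rfl⟩⟩
  haveI : FiniteDimensional K e.fieldRange :=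
    LinearEquiv.finiteDimensional e.equivFieldRange.toLinearEquiv
  rw [hK', e.equivFieldRange.toLinearEquiv.finrank_eq]
  exact (IntermediateField.finrank_eq_fixingSubgroup_index e.fieldRange).symm

variable {p : ℕ} [Fact p.Prime] {k : Type*} [Field k] [CharP k p] [TopologicalSpace k]

/-- **The image of `Γ_ℚ` is `Δ_p ⋊ C₂`** once, in the frame `g`, the image of `Γ_K`
(`K` quadratic) is `Δ_p` (block-diagonal) and the image of `ker χ_p` is `SL₂(𝔽_p) ≀ C₂`: the
block swap `s = antidiag(1, 1)` is the image of some `τ₀ ∈ ker χ_p`, `τ₀ ∉ Γ_K` (its image is not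
block-diagonal), `Γ_ℚ = Γ_K ⊔ τ₀ Γ_K` (`[Γ_ℚ : Γ_K] = 2`, `Subgroup.mul_mem_iff_of_index_two`),
and `s · diag(a, c) = antidiag(c, a)`.  This is the step from the two printed surjectivity
statements of p. 146 ("`G_K → {(A,B) : det A = det B}`" onto; "`ρ̄_{A,p}(G_{ℚ(ζ_{p^∞})})` is
precisely `SL₂(𝔽_p) ≀ ℤ/2ℤ`") to the image of `G_ℚ`.
[cite: BoxerCalegariGeePilloni2025, proof of Lemma 10.4.1 (p. 146)] -/
theorem range_eq_wreath_of_range_restrictField_of_image_ker_cyclotomic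
    (ρb : FramedGaloisRep ℚ k 4) (g : GL (Fin 4) k)
    (K : Type*) [Field K] [NumberField K] (hK2 : Module.finrank ℚ K = 2)
    (hK : Set.range (fun τ : absoluteGaloisGroup K =>
        ((g * ρb (absGaloisRestrict ℚ K τ) * g⁻¹ : GL (Fin 4) k) : Matrix (Fin 4) (Fin 4) k)) =
      {M | ∃ a c : Matrix (Fin 2) (Fin 2) (ZMod p), a.det = c.det ∧ a.det ≠ 0 ∧
        M = Matrix.reindex finSumFinEquiv finSumFinEquiv
            (Matrix.fromBlocks (a.map (ZMod.castHom (dvd_refl p) k)) 0 0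
              (c.map (ZMod.castHom (dvd_refl p) k)))})
    (hSL : (fun τ : absoluteGaloisGroup ℚ =>
        ((g * ρb τ * g⁻¹ : GL (Fin 4) k) : Matrix (Fin 4) (Fin 4) k)) ''
          {τ | GaloisRep.cyclotomicCharacter ℚ p τ = 1} =
      {M | ∃ a c : Matrix (Fin 2) (Fin 2) (ZMod p), a.det = 1 ∧ c.det = 1 ∧
        (M = Matrix.reindex finSumFinEquiv finSumFinEquiv
            (Matrix.fromBlocks (a.map (ZMod.castHom (dvd_refl p) k)) 0 0
              (c.map (ZMod.castHom (dvd_refl p) k))) ∨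
         M = Matrix.reindex finSumFinEquiv finSumFinEquiv
            (Matrix.fromBlocks 0 (a.map (ZMod.castHom (dvd_refl p) k))
              (c.map (ZMod.castHom (dvd_refl p) k)) 0))}) :
    Set.range (fun τ : absoluteGaloisGroup ℚ =>
        ((g * ρb τ * g⁻¹ : GL (Fin 4) k) : Matrix (Fin 4) (Fin 4) k)) =
      {M | ∃ a c : Matrix (Fin 2) (Fin 2) (ZMod p), a.det = c.det ∧ a.det ≠ 0 ∧
        (M = Matrix.reindex finSumFinEquiv finSumFinEquiv
            (Matrix.fromBlocks (a.map (ZMod.castHom (dvd_refl p) k)) 0 0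
              (c.map (ZMod.castHom (dvd_refl p) k))) ∨
         M = Matrix.reindex finSumFinEquiv finSumFinEquiv
            (Matrix.fromBlocks 0 (a.map (ZMod.castHom (dvd_refl p) k))
              (c.map (ZMod.castHom (dvd_refl p) k)) 0))} := by
  set ι := ZMod.castHom (dvd_refl p) k with hι
  set φ : absoluteGaloisGroup ℚ → Matrix (Fin 4) (Fin 4) k := fun τ =>
    ((g * ρb τ * g⁻¹ : GL (Fin 4) k) : Matrix (Fin 4) (Fin 4) k) with hφ
  have hmul : ∀ x y, φ (x * y) = φ x * φ y := fun x y => by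
    simp only [hφ, ← Units.val_mul, map_mul]
    congr 1
    group
  have hι1 : ((1 : Matrix (Fin 2) (Fin 2) (ZMod p)).map ι) = 1 :=
    Matrix.map_one ι (map_zero ι) (map_one ι)
  -- the block swap `s = φ τ₀`, `χ_p(τ₀) = 1`
  obtain ⟨τ₀, -, hτ₀⟩ : Matrix.reindex finSumFinEquiv finSumFinEquiv
      (Matrix.fromBlocks 0 ((1 : Matrix (Fin 2) (Fin 2) (ZMod p)).map ι)
        ((1 : Matrix (Fin 2) (Fin 2) (ZMod p)).map ι) 0) ∈
      φ '' {τ | GaloisRep.cyclotomicCharacter ℚ p τ = 1} := by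
    rw [hφ, hSL]
    exact ⟨1, 1, Matrix.det_one, Matrix.det_one, Or.inr rfl⟩
  -- `Γ_K` has index `2`
  set H : Subgroup (absoluteGaloisGroup ℚ) := (absGaloisRestrict ℚ K).range with hH
  have hidx : H.index = 2 := (index_range_absGaloisRestrict_eq_finrank' ℚ K).trans hK2
  -- images of elements of `Γ_K` are block-diagonal
  have hdiag : ∀ τ ∈ H, ∃ a c : Matrix (Fin 2) (Fin 2) (ZMod p), a.det = c.det ∧ a.det ≠ 0 ∧
      φ τ = Matrix.reindex finSumFinEquiv finSumFinEquiv
        (Matrix.fromBlocks (a.map ι) 0 0 (c.map ι)) := by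
    intro τ hτ
    obtain ⟨σ, hσ⟩ := MonoidHom.mem_range.1 hτ
    have hσ' : absGaloisRestrict ℚ K σ = τ := hσ
    have hmem : φ τ ∈ Set.range (fun τ : absoluteGaloisGroup K =>
        ((g * ρb (absGaloisRestrict ℚ K τ) * g⁻¹ : GL (Fin 4) k) : Matrix (Fin 4) (Fin 4) k)) :=
      ⟨σ, by change φ (absGaloisRestrict ℚ K σ) = φ τ; rw [hσ']⟩
    rw [hK] at hmem
    exact hmem
  have hτ₀H : τ₀ ∉ H := by
    intro h
    obtain ⟨a, c, -, hne, hEq⟩ := hdiag τ₀ h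
    rw [hEq] at hτ₀
    obtain ⟨h1, -, -, -⟩ := SL2Wreath.reindex_fromBlocks_inj hτ₀
    exact hne (SL2Wreath.det_eq_zero_of_map_eq_zero ι h1)
  ext M
  constructor
  · rintro ⟨τ, rfl⟩
    by_cases hτ : τ ∈ H
    · obtain ⟨a, c, hdet, hne, hEq⟩ := hdiag τ hτ
      exact ⟨a, c, hdet, hne, Or.inl hEq⟩
    · have hmem : τ₀⁻¹ * τ ∈ H := by
        rw [Subgroup.mul_mem_iff_of_index_two hidx, inv_mem_iff]
        exact iff_of_false hτ₀H hτ
      obtain ⟨a, c, hdet, hne, hEq⟩ := hdiag _ hmem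
      refine ⟨c, a, hdet.symm, hdet ▸ hne, Or.inr ?_⟩
      change φ τ = _
      rw [show τ = τ₀ * (τ₀⁻¹ * τ) by group, hmul,
        SL2Wreath.mul_eq_of_eq_antidiag_of_eq_diag hτ₀ hEq, hι1, Matrix.one_mul,
        Matrix.one_mul]
  · rintro ⟨a, c, hdet, hne, h | h⟩
    · have hmem : M ∈ Set.range (fun τ : absoluteGaloisGroup K =>
          ((g * ρb (absGaloisRestrict ℚ K τ) * g⁻¹ : GL (Fin 4) k) : Matrix (Fin 4) (Fin 4) k)) := by
        rw [hK]
        exact ⟨a, c, hdet, hne, h⟩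
      obtain ⟨σ, hσ⟩ := hmem
      exact ⟨absGaloisRestrict ℚ K σ, hσ⟩
    · have hmem : Matrix.reindex finSumFinEquiv finSumFinEquiv
          (Matrix.fromBlocks (c.map ι) 0 0 (a.map ι)) ∈
          Set.range (fun τ : absoluteGaloisGroup K =>
            ((g * ρb (absGaloisRestrict ℚ K τ) * g⁻¹ : GL (Fin 4) k) :
              Matrix (Fin 4) (Fin 4) k)) := by
        rw [hK]
        exact ⟨c, a, hdet.symm, hdet ▸ hne, rfl⟩
      obtain ⟨σ, hσ⟩ := hmem
      have hσ' : φ (absGaloisRestrict ℚ K σ) = Matrix.reindex finSumFinEquiv finSumFinEquiv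
          (Matrix.fromBlocks (c.map ι) 0 0 (a.map ι)) := hσ
      refine ⟨τ₀ * absGaloisRestrict ℚ K σ, ?_⟩
      rw [hmul, SL2Wreath.mul_eq_of_eq_antidiag_of_eq_diag hτ₀ hσ', hι1, Matrix.one_mul,
        Matrix.one_mul, h]

/-- **The three image clauses from the two printed ones.**  For `K` quadratic, the images of
`Γ_K` (`= Δ_p`) and of `ker χ_p` (`= SL₂(𝔽_p) ≀ C₂`) in a frame `g` determine the image of `Γ_ℚ`
(`= Δ_p ⋊ C₂`, `range_eq_wreath_of_range_restrictField_of_image_ker_cyclotomic`); packaged as the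
`∃ g, …` triple consumed by `serreWreathResidueConditions_of_images` and by the binder `h758`
(Thm. 7.5.8 at `ρ_{A,p}`) of the reduction of
`bcgp_serreWreathFixedSimilitude_implies_quadraticImprimitiveSurfacesModular`.
[cite: BoxerCalegariGeePilloni2025, proof of Lemma 10.4.1 (p. 146)] -/
theorem wreathImages_of_range_restrictField_of_image_ker_cyclotomic
    (ρb : FramedGaloisRep ℚ k 4) (K : Type*) [Field K] [NumberField K]
    (hK2 : Module.finrank ℚ K = 2)
    (himg : ∃ g : GL (Fin 4) k,
      Set.range (fun τ : absoluteGaloisGroup K =>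
          ((g * ρb (absGaloisRestrict ℚ K τ) * g⁻¹ : GL (Fin 4) k) : Matrix (Fin 4) (Fin 4) k)) =
        {M | ∃ a c : Matrix (Fin 2) (Fin 2) (ZMod p), a.det = c.det ∧ a.det ≠ 0 ∧
          M = Matrix.reindex finSumFinEquiv finSumFinEquiv
              (Matrix.fromBlocks (a.map (ZMod.castHom (dvd_refl p) k)) 0 0
                (c.map (ZMod.castHom (dvd_refl p) k)))} ∧
      (fun τ : absoluteGaloisGroup ℚ =>
          ((g * ρb τ * g⁻¹ : GL (Fin 4) k) : Matrix (Fin 4) (Fin 4) k)) ''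
          {τ | GaloisRep.cyclotomicCharacter ℚ p τ = 1} =
        {M | ∃ a c : Matrix (Fin 2) (Fin 2) (ZMod p), a.det = 1 ∧ c.det = 1 ∧
          (M = Matrix.reindex finSumFinEquiv finSumFinEquiv
              (Matrix.fromBlocks (a.map (ZMod.castHom (dvd_refl p) k)) 0 0
                (c.map (ZMod.castHom (dvd_refl p) k))) ∨
           M = Matrix.reindex finSumFinEquiv finSumFinEquiv
              (Matrix.fromBlocks 0 (a.map (ZMod.castHom (dvd_refl p) k))
                (c.map (ZMod.castHom (dvd_refl p) k)) 0))}) :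
    ∃ g : GL (Fin 4) k,
      Set.range (fun τ : absoluteGaloisGroup ℚ =>
          ((g * ρb τ * g⁻¹ : GL (Fin 4) k) : Matrix (Fin 4) (Fin 4) k)) =
        {M | ∃ a c : Matrix (Fin 2) (Fin 2) (ZMod p), a.det = c.det ∧ a.det ≠ 0 ∧
          (M = Matrix.reindex finSumFinEquiv finSumFinEquiv
              (Matrix.fromBlocks (a.map (ZMod.castHom (dvd_refl p) k)) 0 0
                (c.map (ZMod.castHom (dvd_refl p) k))) ∨
           M = Matrix.reindex finSumFinEquiv finSumFinEquiv
              (Matrix.fromBlocks 0 (a.map (ZMod.castHom (dvd_refl p) k))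
                (c.map (ZMod.castHom (dvd_refl p) k)) 0))} ∧
      Set.range (fun τ : absoluteGaloisGroup K =>
          ((g * ρb (absGaloisRestrict ℚ K τ) * g⁻¹ : GL (Fin 4) k) : Matrix (Fin 4) (Fin 4) k)) =
        {M | ∃ a c : Matrix (Fin 2) (Fin 2) (ZMod p), a.det = c.det ∧ a.det ≠ 0 ∧
          M = Matrix.reindex finSumFinEquiv finSumFinEquiv
              (Matrix.fromBlocks (a.map (ZMod.castHom (dvd_refl p) k)) 0 0
                (c.map (ZMod.castHom (dvd_refl p) k)))} ∧
      (fun τ : absoluteGaloisGroup ℚ =>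
          ((g * ρb τ * g⁻¹ : GL (Fin 4) k) : Matrix (Fin 4) (Fin 4) k)) ''
          {τ | GaloisRep.cyclotomicCharacter ℚ p τ = 1} =
        {M | ∃ a c : Matrix (Fin 2) (Fin 2) (ZMod p), a.det = 1 ∧ c.det = 1 ∧
          (M = Matrix.reindex finSumFinEquiv finSumFinEquiv
              (Matrix.fromBlocks (a.map (ZMod.castHom (dvd_refl p) k)) 0 0
                (c.map (ZMod.castHom (dvd_refl p) k))) ∨
           M = Matrix.reindex finSumFinEquiv finSumFinEquiv
              (Matrix.fromBlocks 0 (a.map (ZMod.castHom (dvd_refl p) k))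
                (c.map (ZMod.castHom (dvd_refl p) k)) 0))} := by
  obtain ⟨g, hK, hSL⟩ := himg
  exact ⟨g, range_eq_wreath_of_range_restrictField_of_image_ker_cyclotomic ρb g K hK2 hK hSL,
    hK, hSL⟩

end GaloisImage

end Literature.NumberTheory.GaloisRepresentations
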